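import Summits.AnomalousDissipation.AnomalousDissipation.Theorems.RelaxingFamily.Negative.LinearEnstrophyBudget
import Summits.AnomalousDissipation.AnomalousDissipation.Theorems.RelaxingFamily.Negative.WeakScalarTimeDilation
import Literature.Analysis.FluidPDE.LerayHopfUniformEnergyMomentum
import Literature.Analysis.FluidPDE.AlexakisDoeringInterpolation
import HarnessLib

/-!
# Negative knowledge for the crux `RelaxingFamily` (stmt-AnomalousDissipation-15009), IV: the
# quantitative Seis floor — sub-logarithmic enstrophy budgets are excluded

Refuted strengthening (`_false_without_` shape, cdisprove seat) of
`Summit.AnomalousDissipation.AnomalousDissipation.Theses.LimitingAbsorption.RelaxingFamily` (route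
`route-AnomalousDissipation-LimitingAbsorption`, crux r3; supports stmt-AnomalousDissipation-15009),
sharpening `Negative/LinearEnstrophyBudget.lean` (one `j`-uniform slope `M`) to LEVEL-DEPENDENT slopes
`M_j = o(log(1/ν_j))` — the "`Z_j ≳ γ² log²(1/ν_j)`" of the route's why-might-fail, as a theorem — with
the time-dilation tool of `Negative/WeakScalarTimeDilation.lean`:

* `SublogEnstrophyBudget` — level-dependent slopes `M_j ≥ 1` with `M_j / log(1/ν_j) → 0` and, from some
  phase `s_j ≥ 0`, the homogeneous windowed budget `∫₀ᵗ ‖∇v_j(s_j+τ)‖₂ dτ ≤ M_j t` for all `t > 0`.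
* `relaxingFamily_false_without_logEnstrophy : ¬ RelaxingFamilyUnder SublogEnstrophyBudget` —
  UNCONDITIONAL: dilate time by `M_j` (`θ̃(t) = θ(t/M_j)`, drift `v_j(s_j + t/M_j)/M_j`, diffusivity
  `ν_j/M_j ≤ ν_j`): the dilated drift has slope-`1` budget and (since `M_j ≥ 1`) smaller energy, the
  dilated scalar relaxes at rate `γ/M_j`, and Seis' Remark 1 at slope `1` (constants depending on `h, C`
  only) gives `γ/(2M_j) ≤ K₁/log(M_j/ν_j) ≤ K₁/log(1/ν_j)`, i.e. `M_j ≥ (γ/2K₁) log(1/ν_j)`.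
* `RelaxingFamilyUnder.subseq`, `relaxingFamilyUnder_frequently_imp` — SUBSEQUENCE PRINCIPLE: a witness
  restricted to a subsequence of levels is a witness, so per-level extra hypotheses need only hold at
  infinitely many levels (`relaxingFamily_false_without_superlinearEnstrophy_frequently`), and the log
  floor holds in `liminf` form (`relaxingFamily_false_without_logEnstrophy_liminf`).

Reading: a witness of the crux needs, from EVERY phase, windowed mean `‖∇v_j‖_{L²} ≥ (γ/2K₁) log(1/ν_j)`
for ALL large `j` — mean enstrophy `≳ γ² log²(1/ν_j)` — at bounded energy.

## References

* C. Seis, Comm. Math. Phys. 399 (2023) = arXiv:2003.08794, Thm. 2, Rmk. 1 and the scaling remark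
  (p. 4). [`Seis2022`]
-/

noncomputable section

open MeasureTheory Set Filter Function TopologicalSpace Topology
open scoped ENNReal NNReal InnerProductSpace

namespace Summit.AnomalousDissipation.AnomalousDissipation.Theorems.RelaxingFamily.Negative

-- D-0017: single-problem summit ⇒ `Summit.AnomalousDissipation.AnomalousDissipation.…` by design.
set_option linter.dupNamespace false

open Literature.Analysis.FunctionSpaces Literature.Analysis.FunctionSpaces.Torus
open Literature.Analysis.FluidPDE Literature.Analysis.FluidPDE.Torus
open Summit.AnomalousDissipation.AnomalousDissipation.Theses.LimitingAbsorption

/-! ## The excluded class: sub-logarithmic budgets -/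

/-- The unit flat 2-torus (local notation). -/
local notation "𝕋²" => UnitAddTorus (Fin 2)
/-- Planar vectors (local notation). -/
local notation "E²" => EuclideanSpace ℝ (Fin 2)

/-- **Sub-logarithmic homogeneous budget**: level-dependent slopes `M_j ≥ 1` with
`M_j / log(1/ν_j) → 0` and, from some phase `s_j ≥ 0`, the HOMOGENEOUS windowed budget
`∫₀ᵗ ‖∇v_j(s_j + τ)‖_{L²} dτ ≤ M_j t` for all `t > 0` (`‖∇w‖_{L²} = (eGradNormSq w)^{1/2}`;
homogeneity is what the time dilation consumes — the arg-max phase lemma of `Negative/SingleShell.lean`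
produces homogeneous budgets from Cesàro bounds). -/
def SublogEnstrophyBudget (_g : 𝕋² → E²) (_h : 𝕋² → ℝ) (ν : ℕ → ℝ) (v : ℕ → ℝ → 𝕋² → E²) : Prop :=
  ∃ M : ℕ → ℝ, (∀ j, 1 ≤ M j) ∧ Tendsto (fun j => M j / Real.log (ν j)⁻¹) atTop (𝓝 0) ∧
    ∀ j : ℕ, ∃ s : ℝ, 0 ≤ s ∧ ∀ t : ℝ, 0 < t →
      ∫⁻ τ in Ioo 0 t, eGradNormSq (v j (s + τ)) ^ (1 / 2 : ℝ) ≤ ENNReal.ofReal (M j * t)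

/-- **`RelaxingFamily` is false without logarithmic enstrophy growth** (the quantitative Seis floor,
unconditional): no witness of the crux has windowed gradient budgets of slope `M_j = o(log(1/ν_j))`
from some phase on. Any proof of `RelaxingFamily` must produce planar Leray–Hopf families whose windowed
mean `‖∇v_j‖_{L²}` is `≳ log(1/ν_j)` from every phase while the energy stays bounded.
[cite: Seis2022, Thm 2, Remark 1 and scaling remark (arXiv:2003.08794 p. 4)] -/
theorem relaxingFamily_false_without_logEnstrophy : ¬ RelaxingFamilyUnder SublogEnstrophyBudget := by
  rintro ⟨g, h, hg, -, hgm, hh, hhm, hh0, ν, v₀, v, hν, hνlim, hLH, hbd, -, ⟨M, hM1, hMlim, hbudget⟩,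
    C, γ, hC, hγ, hrelax⟩
  -- profile constants
  have ha : 0 < ∫ x, |h x| := integral_abs_pos_of_ne_zero hh hh0
  have hS : 0 < scalarL2Sq h := scalarL2Sq_pos_of_ne_zero hh hh0
  set C₀ : ℝ := Real.sqrt ((C + 1) * scalarL2Sq h) with hC₀def
  have hC₀sq : C₀ ^ 2 = (C + 1) * scalarL2Sq h := Real.sq_sqrt (by positivity)
  have hC₀ : 0 < C₀ := Real.sqrt_pos.2 (by positivity)
  -- Seis' constants at slope `1`
  obtain ⟨κ₀, K, hκ₀, hκ₁, hK, hSeis⟩ :=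
    Seis2022_rmk1_L2_holds (d := Fin 2) (∫ x, |h x|) (∫ x, |h x|) (∫ x, ‖Torus.gradient h x‖) C₀ 1
      ha hC₀ zero_le_one
  -- the level `j`: `ν_j < κ₀` and `M_j / log(1/ν_j) < ε`
  set ε : ℝ := γ / (2 * K + 2) with hε
  have hεpos : 0 < ε := by positivity
  obtain ⟨j, hjκ, hjM⟩ : ∃ j, ν j < κ₀ ∧ M j / Real.log (ν j)⁻¹ < ε :=
    ((hνlim.eventually (gt_mem_nhds hκ₀)).and (hMlim.eventually (gt_mem_nhds hεpos))).exists
  have hνj := hν j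
  have hν1 : ν j < 1 := hjκ.trans hκ₁
  have hL : 0 < Real.log (ν j)⁻¹ := Real.log_pos ((one_lt_inv₀ hνj).2 hν1)
  have hMj : 1 ≤ M j := hM1 j
  have hMpos : 0 < M j := one_pos.trans_le hMj
  -- the phase and the budget at level `j`
  obtain ⟨s, hs, hbud⟩ := hbudget j
  -- the dilation factor `c = 1/M_j ∈ (0, 1]`
  set c : ℝ := (M j)⁻¹ with hcdef
  have hcpos : 0 < c := inv_pos.2 hMpos
  have hc1 : c ≤ 1 := inv_le_one_of_one_le₀ hMj
  have hcM : c * M j = 1 := inv_mul_cancel₀ hMpos.ne'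
  -- the drift `v_j(s + ·)` is bounded on every `(0,T) × T²`; glue a global weak scalar
  have hu : ∀ T : ℝ, 0 < T →
      MemLp (stLift fun t => v j (s + t)) ⊤ (volume.restrict (Ioo (0 : ℝ) T ×ˢ univ)) := by
    intro T hT
    have := LapInventory.memLp_top_stLift_comp_const_add hs (hbd j (s + T) (by linarith))
    rwa [show s + T - s = T by ring] at this
  have hex : ∀ T : ℝ, 0 < T → ∃ θ : ℝ → 𝕋² → ℝ,
      IsWeakScalarTransportOn T (ν j) (fun t => v j (s + t)) h θ := fun T hT =>
    let ⟨θ, hθ, _⟩ := (hLH j).exists_release (hν j) hT hs (hh.memLp 2)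
    ⟨θ, hθ⟩
  obtain ⟨θ, hθ⟩ := exists_global_isWeakScalarTransportOn (hν j) hu hex
  -- the decay clause along `θ`, for a.e. `t > 0`
  have hdec0 : ∀ᵐ t ∂(volume.restrict (Ioi (0 : ℝ))),
      scalarL2Sq (θ t) ≤ C * Real.exp (-(γ * t)) * scalarL2Sq h := by
    have hall : ∀ᵐ t ∂(volume : Measure ℝ), ∀ n : ℕ, t ∈ Ioo (0 : ℝ) ((n : ℝ) + 1) →
        scalarL2Sq (θ t) ≤ C * Real.exp (-(γ * t)) * scalarL2Sq h :=
      ae_all_iff.2 fun n => (ae_restrict_iff' measurableSet_Ioo).1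
        (hrelax j s hs _ θ (hθ _ (by positivity)))
    rw [ae_restrict_iff' measurableSet_Ioi]
    filter_upwards [hall] with t ht ht0
    exact ht ⌊t⌋₊ ⟨ht0, Nat.lt_floor_add_one t⟩
  -- DILATE: `θ̃ t = θ (c t)`, drift `c • v_j(s + c t)`, diffusivity `c ν_j`
  have hθt : ∀ T : ℝ, 0 < T → IsWeakScalarTransportOn T (c * ν j)
      (fun t => c • (fun t => v j (s + t)) (c * t)) h (fun t => θ (c * t)) := fun T hT =>
    isWeakScalarTransportOn_comp_mul hcpos (hθ (c * T) (by positivity))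
  -- (i) diffusivity
  have hκle : c * ν j ≤ κ₀ := (mul_le_of_le_one_left hνj.le hc1).trans hjκ.le
  -- (ii) energy of the dilated drift (mean-zero force ⇒ bounded energy, FMRT (3.2); `c ≤ 1`)
  obtain ⟨R, hR⟩ := (hLH j).exists_forall_integral_norm_sq_le_of_hasZeroMean (hν j) (hg.memLp 2) hgm
  have hEn : ∃ M' : ℝ≥0, ∀ᵐ t ∂(volume.restrict (Ioi (0 : ℝ))),
      ∫⁻ x, ‖(fun t => c • (fun t => v j (s + t)) (c * t)) t x‖ₑ ^ 2 ≤ M' := by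
    refine ⟨R.toNNReal, (ae_restrict_mem measurableSet_Ioi).mono fun t ht => ?_⟩
    have ht0 : 0 < t := ht
    have hst : 0 ≤ s + c * t := by positivity
    show ∫⁻ x, ‖c • v j (s + c * t) x‖ₑ ^ 2 ≤ _
    rw [lintegral_enorm_sq_const_smul,
      Literature.Analysis.FluidPDE.lintegral_enorm_sq_eq_ofReal ((hLH j).memLp_two hst)]
    have h1 : ENNReal.ofReal (c ^ 2) ≤ 1 := ENNReal.ofReal_le_one.2 (by nlinarith)
    calc ENNReal.ofReal (c ^ 2) * ENNReal.ofReal (∫ x, ‖v j (s + c * t) x‖ ^ 2)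
        ≤ 1 * ENNReal.ofReal (∫ x, ‖v j (s + c * t) x‖ ^ 2) := mul_le_mul' h1 le_rfl
      _ ≤ ENNReal.ofReal R := by rw [one_mul]; exact ENNReal.ofReal_le_ofReal (hR _ hst)
  -- (iii) slope-1 budget of the dilated drift
  have hB : ∀ t : ℝ, 0 < t →
      ∫⁻ τ in Ioo 0 t, eGradNormSq ((fun t => c • (fun t => v j (s + t)) (c * t)) τ) ^ (1 / 2 : ℝ) ≤
        ENNReal.ofReal (1 * (1 + t)) := by
    intro t ht
    have e : ∀ τ, eGradNormSq ((fun t => c • (fun t => v j (s + t)) (c * t)) τ) ^ (1 / 2 : ℝ) =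
        ENNReal.ofReal c * eGradNormSq (v j (s + c * τ)) ^ (1 / 2 : ℝ) := by
      intro τ
      show eGradNormSq (c • v j (s + c * τ)) ^ (1 / 2 : ℝ) = _
      rw [eGradNormSq_const_smul_eq, ENNReal.mul_rpow_of_nonneg _ _ (by norm_num),
        ofReal_rpow_half_eq_ofReal_sqrt, Real.sqrt_sq hcpos.le]
    simp_rw [e]
    rw [lintegral_const_mul' _ _ ENNReal.ofReal_ne_top,
      setLIntegral_Ioo_comp_mul (fun σ => eGradNormSq (v j (s + σ)) ^ (1 / 2 : ℝ)) hcpos t,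
      ← mul_assoc, ← ENNReal.ofReal_mul hcpos.le, mul_inv_cancel₀ hcpos.ne', ENNReal.ofReal_one,
      one_mul]
    calc ∫⁻ σ in Ioo 0 (c * t), eGradNormSq (v j (s + σ)) ^ (1 / 2 : ℝ)
        ≤ ENNReal.ofReal (M j * (c * t)) := hbud (c * t) (by positivity)
      _ = ENNReal.ofReal t := by rw [← mul_assoc, mul_comm (M j) c, hcM, one_mul]
      _ ≤ ENNReal.ofReal (1 * (1 + t)) := ENNReal.ofReal_le_ofReal (by linarith)
  -- (iv) decay of the dilated scalar at rate `c γ`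
  have hdec : ∀ᵐ t ∂(volume.restrict (Ioi (0 : ℝ))),
      scalarL2Sq ((fun t => θ (c * t)) t) ≤ (C₀ * Real.exp (-(c * γ / 2 * t))) ^ 2 := by
    filter_upwards [ae_restrict_Ioi_comp_mul hcpos hdec0] with t ht
    have hexp : (C₀ * Real.exp (-(c * γ / 2 * t))) ^ 2 =
        (C + 1) * scalarL2Sq h * Real.exp (-(γ * (c * t))) := by
      rw [mul_pow, hC₀sq, ← Real.exp_nat_mul]
      congr 1; push_cast; ring_nf
    show scalarL2Sq (θ (c * t)) ≤ _
    rw [hexp]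
    have hE : 0 ≤ Real.exp (-(γ * (c * t))) := (Real.exp_pos _).le
    nlinarith [hS.le]
  -- Seis' Remark 1 at slope `1` for the dilated problem
  have hD : c * γ / 2 ≤ K / Real.log (c * ν j)⁻¹ :=
    hSeis (c * ν j) (c * γ / 2) _ h _ (by positivity) hκle hEn hB hh hhm le_rfl le_rfl le_rfl
      hθt hdec
  -- `log(1/ν_j) ≤ log(M_j/ν_j)`
  have hlog : Real.log (ν j)⁻¹ ≤ Real.log (c * ν j)⁻¹ :=
    Real.log_le_log (inv_pos.2 hνj) (inv_anti₀ (by positivity) (mul_le_of_le_one_left hνj.le hc1))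
  have hD' : c * γ / 2 ≤ K / Real.log (ν j)⁻¹ :=
    hD.trans (div_le_div_of_nonneg_left hK hL hlog)
  -- arithmetic: `γ log(1/ν_j) ≤ 2 K M_j` against `M_j < ε log(1/ν_j)`
  set L : ℝ := Real.log (ν j)⁻¹ with hLdef
  rw [le_div_iff₀ hL] at hD'
  have key1 : γ * L ≤ 2 * K * M j := by
    have := mul_le_mul_of_nonneg_left hD' hMpos.le
    have e : M j * (c * γ / 2 * L) = γ * L / 2 := by
      rw [hcdef]; field_simp
    rw [e] at this
    linarith
  have key2 : M j < ε * L := (div_lt_iff₀ hL).1 hjM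
  have key3 : 2 * K * (ε * L) < γ * L := by
    have hlt : 2 * K / (2 * K + 2) < 1 := by rw [div_lt_one (by positivity)]; linarith
    calc 2 * K * (ε * L) = 2 * K / (2 * K + 2) * (γ * L) := by rw [hε]; field_simp
      _ < 1 * (γ * L) := mul_lt_mul_of_pos_right hlt (by positivity)
      _ = γ * L := one_mul _
  have key4 : 2 * K * M j ≤ 2 * K * (ε * L) := mul_le_mul_of_nonneg_left key2.le (by positivity)
  linarith

/-! ## Subsequence principle: per-level hypotheses need only hold along a subsequence -/

/-- **Subsequence principle.** A witness of the crux restricted to any subsequence of levels is a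
witness of the crux; hence an extra hypothesis met along SOME subsequence of levels transfers.
[folklore] -/
theorem RelaxingFamilyUnder.subseq
    {H₁ H₂ : (𝕋² → E²) → (𝕋² → ℝ) → (ℕ → ℝ) → (ℕ → ℝ → 𝕋² → E²) → Prop}
    (h1 : RelaxingFamilyUnder H₁)
    (h12 : ∀ g h ν v, (∀ j, 0 < ν j) → Tendsto ν atTop (𝓝 0) → H₁ g h ν v →
      ∃ φ : ℕ → ℕ, StrictMono φ ∧ H₂ g h (ν ∘ φ) (fun j => v (φ j))) :
    RelaxingFamilyUnder H₂ := by
  obtain ⟨g, h, hg, hgd, hgm, hh, hhm, hh0, ν, v₀, v, hν, hνlim, hLH, hbd, ⟨E, hE⟩, hH, C, γ, hC, hγ,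
    hrelax⟩ := h1
  obtain ⟨φ, hφ, hH₂⟩ := h12 g h ν v hν hνlim hH
  exact ⟨g, h, hg, hgd, hgm, hh, hhm, hh0, ν ∘ φ, fun j => v₀ (φ j), fun j => v (φ j),
    fun j => hν (φ j), hνlim.comp hφ.tendsto_atTop, fun j => hLH (φ j), fun j => hbd (φ j),
    ⟨E, fun j => hE (φ j)⟩, hH₂, C, γ, hC, hγ, fun j => hrelax (φ j)⟩

/-- **Per-level classes need only hold frequently.** If `¬ RelaxingFamilyUnder (∀ j, P j)` for a
per-level property `P` of `(g, h, ν_j, v_j)`, then already `¬ RelaxingFamilyUnder (∃ᶠ j, P j)`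
(extract the subsequence of good levels, `Filter.extraction_of_frequently_atTop`). [folklore] -/
theorem relaxingFamilyUnder_frequently_imp
    {P : (𝕋² → E²) → (𝕋² → ℝ) → ℝ → (ℝ → 𝕋² → E²) → Prop}
    (hall : ¬ RelaxingFamilyUnder fun g h ν v => ∀ j, P g h (ν j) (v j)) :
    ¬ RelaxingFamilyUnder fun g h ν v => ∃ᶠ j in atTop, P g h (ν j) (v j) := by
  intro hf
  refine hall (hf.subseq fun g h ν v _ _ hfr => ?_)
  obtain ⟨φ, hφ, hP⟩ := extraction_of_frequently_atTop hfr
  exact ⟨φ, hφ, fun j => hP j⟩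

/-- **Linear budget at infinitely many levels** (one slope `M`) is excluded — sharpening of
`relaxingFamily_false_without_superlinearEnstrophy` from "every level" to "frequently many levels".
[cite: Seis2022, Remark 1 (arXiv:2003.08794 p. 4)] -/
theorem relaxingFamily_false_without_superlinearEnstrophy_frequently :
    ¬ RelaxingFamilyUnder fun _g _h _ν v => ∃ M : ℝ, 0 ≤ M ∧ ∃ᶠ j in atTop, ∃ s : ℝ, 0 ≤ s ∧
      (∃ M' : ℝ≥0, ∀ᵐ t ∂(volume.restrict (Ioi (0 : ℝ))), ∫⁻ x, ‖v j (s + t) x‖ₑ ^ 2 ≤ M') ∧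
      ∀ t : ℝ, 0 < t →
        ∫⁻ τ in Ioo 0 t, eGradNormSq (v j (s + τ)) ^ (1 / 2 : ℝ) ≤ ENNReal.ofReal (M * (1 + t)) := by
  intro hf
  refine relaxingFamily_false_without_superlinearEnstrophy (hf.subseq fun g h ν v _ _ ⟨M, hM, hfr⟩ => ?_)
  obtain ⟨φ, hφ, hP⟩ := extraction_of_frequently_atTop hfr
  exact ⟨φ, hφ, M, hM, fun j => hP j⟩

/-- **`liminf` form of the quantitative floor.** It is even excluded that the slopes are
sub-logarithmic along SOME subsequence of levels: if `M_j ≥ 1` are homogeneous windowed budgets from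
some phase on and `M_j / log(1/ν_j) < ε` for every `ε > 0` at infinitely many levels, there is no
witness. Equivalently: along any witness, every admissible slope sequence has
`liminf_j M_j / log(1/ν_j) ≥ γ/(2K₁) > 0`. [cite: Seis2022, Thm 2, Remark 1 and scaling remark (arXiv:2003.08794 p. 4)] -/
theorem relaxingFamily_false_without_logEnstrophy_liminf :
    ¬ RelaxingFamilyUnder fun _g _h ν v => ∃ M : ℕ → ℝ, (∀ j, 1 ≤ M j) ∧
      (∀ ε : ℝ, 0 < ε → ∃ᶠ j in atTop, M j / Real.log (ν j)⁻¹ < ε) ∧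
      ∀ j : ℕ, ∃ s : ℝ, 0 ≤ s ∧ ∀ t : ℝ, 0 < t →
        ∫⁻ τ in Ioo 0 t, eGradNormSq (v j (s + τ)) ^ (1 / 2 : ℝ) ≤ ENNReal.ofReal (M j * t) := by
  intro hf
  refine relaxingFamily_false_without_logEnstrophy
    (hf.subseq fun g h ν v hν hνlim ⟨M, hM1, hfr, hb⟩ => ?_)
  -- extract `φ` with `M (φ n) / log(1/ν (φ n)) < 1/(n+1)`
  have hfr' : ∀ n : ℕ, ∃ᶠ j in atTop, M j / Real.log (ν j)⁻¹ < 1 / ((n : ℝ) + 1) := fun n =>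
    hfr _ (by positivity)
  obtain ⟨φ, hφ, hP⟩ := extraction_forall_of_frequently hfr'
  refine ⟨φ, hφ, M ∘ φ, fun j => hM1 (φ j), ?_, fun j => hb (φ j)⟩
  -- the extracted ratios are eventually nonnegative (`ν → 0`) and below `1/(n+1)`
  have hνφ : Tendsto (ν ∘ φ) atTop (𝓝 0) := hνlim.comp hφ.tendsto_atTop
  have hpos : ∀ᶠ n in atTop, 0 ≤ M (φ n) / Real.log (ν (φ n))⁻¹ := by
    filter_upwards [hνφ.eventually (gt_mem_nhds one_pos)] with n hn
    have hL : 0 < Real.log (ν (φ n))⁻¹ := Real.log_pos ((one_lt_inv₀ (hν (φ n))).2 hn)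
    exact div_nonneg (zero_le_one.trans (hM1 (φ n))) hL.le
  show Tendsto (fun n => M (φ n) / Real.log (ν (φ n))⁻¹) atTop (𝓝 0)
  exact tendsto_of_tendsto_of_tendsto_of_le_of_le' tendsto_const_nhds
    tendsto_one_div_add_atTop_nhds_zero_nat hpos (Eventually.of_forall fun n => (hP n).le)

end Summit.AnomalousDissipation.AnomalousDissipation.Theorems.RelaxingFamily.Negative

end
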